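import Literature.AnabelianGeometry.SemiGraphs.Example28CoverticialNecessity
import Literature.AnabelianGeometry.Anabelioids.FiniteEtaleLocalDictionaryStabilizer
import Literature.AnabelianGeometry.Anabelioids.FreeObjects
import Literature.AnabelianGeometry.Anabelioids.GaloisFullSubcategory
import HarnessLib

/-!
# [SemiAnbd] Example 2.8, coverticial half — the universally-sub-coverticial clause, necessity

Mochizuki, *Semi-graphs of anabelioids*, Publ. RIMS **42** (2006) 221–322, §2, Example 2.8, author's
manuscript p. 31 [cite: MochizukiSemiAnbd2006, Ex. 2.8 p.31]: if `𝒢_e` is trivial for all edges `e`,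
"a closed edge abutting to vertices `v`, `w` is … universally sub-coverticial [only if] both `Π_v` and
`Π_w` are infinite".

PROOF-ONLY companion (abc-iut cell, layer L3, row W4-31; named fact
`SemiGraphOfAnabelioids.example_2_8_coverticial` of `Coverticial.lean` rev 4, FACT-LIST F-1474,
statement owner abc-iut-L3-t1; sequel of `Example28Coverticial{Proofs,LoopCounterexample,Necessity,
Universal}`).  The "only if" of the SECOND conjunct holds AS TYPED (loops included), so that the
second conjunct of the named fact is a THEOREM as typed and its only defect is the "only if" of the
first conjunct at a loop (`not_example_2_8_coverticial`):

* `SemiGraphOfAnabelioids.infinite_of_isUniversallySubCoverticial` — trivial edge anabelioids,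
  `e` joins `v`, `w`, `e` universally sub-coverticial ⇒ `Π_v` infinite (at every basepoint).
  If `Π_v` were finite, let `X` be a "universal covering" of `𝒢_v` (a free Galois object,
  abc-iut-L6-t18's `exists_isGalois_free`) and take the object `A` of `B(𝒢)` with
  `S_v = X ⊔ X ⊔ (padding)`, `S_u = 1 ⊔ 1 ⊔ (padding)` elsewhere, `T_f = N · 1`, glued (every bijection
  of fibres is an isomorphism) so that the sheet `0` of `T_e` lies under the FIRST copy along `b₁`
  and under the SECOND copy along `b₂`: in `𝒢_A` the edge `(e, 0)` then joins the vertex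
  `(v, X₁)` to a DIFFERENT vertex, and `Π_{(v, X₁)}` — the stabiliser of a point of the free `X`
  (abc-iut-L6-t17's local dictionary) — is trivial; by `nontrivial_of_isSubCoverticial_of_ne` the
  edge `(e, 0)` is not sub-coverticial, contradicting universal sub-coverticiality;
* `SemiGraphOfAnabelioids.infinite_and_infinite_of_isUniversallySubCoverticial` — the same at both
  ends.  (The assembly with the sufficiency `isUniversallySubCoverticial_of_infinite` — the second
  conjunct verbatim, and the closer of abc-iut-L3-t1's repaired fact `example_2_8_coverticial'` — is
  the sequel `Example28CoverticialRepairedHolds.lean`.)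

No definition; nothing here takes a side on [IUTchIII] Cor. 3.12.
-/

namespace Literature.AnabelianGeometry.SemiGraphs

open CategoryTheory CategoryTheory.Limits CategoryTheory.PreGaloisCategory
open Literature.AnabelianGeometry.Anabelioids

universe v₁ u₁ u

namespace SemiGraphOfAnabelioids

variable {𝒢 : SemiGraphOfAnabelioids.{v₁, u₁, u}}

/-- Fibre images of `Subobject.mk f` and of `f` agree. [folklore] -/
private theorem range_map_mk_arrow'' {C : Type u₁} [Category.{v₁} C] (G : C ⥤ FintypeCat.{v₁})
    {Y Z : C} (f : Z ⟶ Y) [Mono f] :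
    Set.range (G.map (Subobject.mk f).arrow) = Set.range (G.map f) := by
  ext y
  constructor
  · rintro ⟨p, rfl⟩
    refine ⟨G.map (Subobject.underlyingIso f).hom p, ?_⟩
    rw [← FintypeCat.comp_apply, ← G.map_comp, Subobject.underlyingIso_hom_comp_eq_mk]
  · rintro ⟨z, rfl⟩
    refine ⟨G.map (Subobject.underlyingIso f).inv z, ?_⟩
    rw [← FintypeCat.comp_apply, ← G.map_comp, Subobject.underlyingIso_arrow]

/-- Freeness of the `π₁`-action on a fibre transfers along an isomorphism of objects. [folklore] -/
private theorem free_of_iso {C : Type u₁} [Category.{v₁} C] [GaloisCategory C]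
    (G : C ⥤ FintypeCat.{v₁}) [FiberFunctor G] {X Y : C} (i : Y ≅ X)
    (hX : ∀ (σ : Aut G) (x : G.obj X), σ • x = x → σ = 1) :
    ∀ (σ : Aut G) (y : G.obj Y), σ • y = y → σ = 1 := by
  intro σ y hy
  apply hX σ (G.map i.hom y)
  rw [mulAction_naturality, hy]

/-- **[SemiAnbd] Example 2.8, coverticial half, second conjunct — necessity at `v` AS TYPED**
(p. 31, "universally sub-coverticial [only if] `Π_v` and `Π_w` are infinite", loops included): for
`𝒢` with trivial edge anabelioids and a closed edge `e` joining `v` to `w`, if `e` is universally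
sub-coverticial then `Π_v` is infinite at every basepoint. [cite: MochizukiSemiAnbd2006, Ex. 2.8 p.31] -/
theorem infinite_of_isUniversallySubCoverticial (hE : 𝒢.HasTrivialEdgeAnabelioids)
    {e : 𝒢.graph.Edge} {v w : 𝒢.graph.Vertex} (hj : 𝒢.graph.Joins e v w)
    (hU : 𝒢.IsUniversallySubCoverticial e)
    (F : 𝒢.V v ⥤ FintypeCat.{v₁}) [FiberFunctor F] : Infinite (Aut F) := by
  classical
  by_contra hF
  haveI : Finite (Aut F) := not_infinite_iff_finite.mp hF
  obtain ⟨b₁, b₂, hb12, hb₁, hb₂, ha₁, ha₂⟩ := hj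
  -- a "universal covering" of `𝒢_v`: a free Galois object `X`
  obtain ⟨X, hXgal, hXfree, -⟩ := exists_isGalois_free F
  haveI := hXgal
  have hXfree' : ∀ (G : 𝒢.V v ⥤ FintypeCat.{v₁}) [FiberFunctor G] (σ : Aut G) (x : G.obj X),
      σ • x = x → σ = 1 := by
    intro G _
    obtain ⟨i⟩ := nonempty_iso_of_fiberFunctor F G
    exact free_of_iso_fiberFunctor i hXfree
  -- basepoints
  let FV : ∀ u : 𝒢.graph.Vertex, 𝒢.V u ⥤ FintypeCat.{v₁} := fun u =>
    GaloisCategory.getFiberFunctor (𝒢.V u)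
  let FE : ∀ f : 𝒢.graph.Edge, 𝒢.E f ⥤ FintypeCat.{v₁} := fun f =>
    GaloisCategory.getFiberFunctor (𝒢.E f)
  -- at every vertex a connected object: `X` at `v` (free), `1` elsewhere
  let n : ℕ := Nat.card ((FV v).obj X)
  have hn : 1 ≤ n := Nat.one_le_iff_ne_zero.mpr (Nat.card_ne_zero.mpr ⟨inferInstance, inferInstance⟩)
  have hC : ∀ u : 𝒢.graph.Vertex, ∃ C : 𝒢.V u, PreGaloisCategory.IsConnected C ∧
      (∀ (_ : u = v) (G : 𝒢.V u ⥤ FintypeCat.{v₁}) [FiberFunctor G] (σ : Aut G) (x : G.obj C),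
        σ • x = x → σ = 1) ∧ Nat.card ((FV u).obj C) ≤ n := by
    intro u
    by_cases hu : u = v
    · subst hu
      exact ⟨X, inferInstance, fun _ G _ => hXfree' G, le_rfl⟩
    · refine ⟨⊤_ (𝒢.V u), isConnected_terminal, fun h => (hu h).elim, ?_⟩
      obtain ⟨eq⟩ := nonempty_equiv_fiber_terminal_punit (FV u)
      rw [Nat.card_congr eq, Nat.card_unique]
      exact hn
  choose Cobj hCconn hCfree hCle using hC
  let c : 𝒢.graph.Vertex → ℕ := fun u => Nat.card ((FV u).obj (Cobj u))
  let N : ℕ := 2 * n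
  have hN : 1 ≤ N := by omega
  -- Step 2: the object `A`: `S_u = C_u ⊔ (C_u ⊔ padding)`, `T_f = N · 1`
  let S : ∀ u : 𝒢.graph.Vertex, 𝒢.V u := fun u =>
    Cobj u ⨿ (Cobj u ⨿ (∐ fun _ : Fin (N - 2 * c u) => ⊤_ (𝒢.V u)))
  let ι₁ : ∀ u, Cobj u ⟶ S u := fun u => coprod.inl
  let ι₂ : ∀ u, Cobj u ⟶ S u := fun u => coprod.inl ≫ coprod.inr
  -- the copy under which the sheet `0` is to lie along a branch: the second along `b₂`, else the first
  let ιb : ∀ (β : 𝒢.graph.Branch) (u : 𝒢.graph.Vertex), Cobj u ⟶ S u := fun β u =>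
    if β = b₂ then ι₂ u else ι₁ u
  have hιb₁ : ιb b₁ = ι₁ := funext fun u => if_neg hb12
  have hιb₂ : ιb b₂ = ι₂ := funext fun u => if_pos rfl
  haveI hιmono : ∀ β u, Mono (ιb β u) := by
    intro β u
    by_cases hβ : β = b₂
    · simp only [ιb, if_pos hβ, ι₂]; exact mono_comp _ _
    · simp only [ιb, if_neg hβ, ι₁]; infer_instance
  let T : ∀ f : 𝒢.graph.Edge, 𝒢.E f := fun f => ∐ fun _ : Fin N => ⊤_ (𝒢.E f)
  have htE : ∀ f : 𝒢.graph.Edge, Nonempty ((FE f).obj (⊤_ (𝒢.E f))) := fun f =>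
    (nonempty_equiv_fiber_terminal_punit (FE f)).map fun eq => eq.symm PUnit.unit
  let tE : ∀ f : 𝒢.graph.Edge, (FE f).obj (⊤_ (𝒢.E f)) := fun f => (htE f).some
  let sheet : ∀ f : 𝒢.graph.Edge, Fin N → (FE f).obj (T f) := fun f s =>
    (FE f).map (Sigma.ι (fun _ : Fin N => ⊤_ (𝒢.E f)) s) (tE f)
  have hsheet : ∀ f, Function.Bijective (sheet f) := fun f =>
    ⟨TrivialObj.map_ι_injective (FE f) (tE f), fun x => by
      obtain ⟨j, rfl⟩ := TrivialObj.exists_eq_map_ι (FE f) (tE f) x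
      exact ⟨j, rfl⟩⟩
  have hcardS : ∀ (u : 𝒢.graph.Vertex) (G : 𝒢.V u ⥤ FintypeCat.{v₁}) [FiberFunctor G],
      Nat.card (G.obj (S u)) = N := by
    intro u G _
    change Nat.card (G.obj (Cobj u ⨿ (Cobj u ⨿ (∐ fun _ : Fin (N - 2 * c u) => ⊤_ (𝒢.V u))))) = N
    rw [card_fiber_coprod_eq_sum, card_fiber_coprod_eq_sum, TrivialObj.card_fiber, Nat.card_fin,
      card_fiber_eq_of_fiberFunctor G (FV u)]
    have hcu : c u ≤ n := hCle u
    change c u + (c u + (N - 2 * c u)) = N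
    omega
  -- the basepoints `β^* ⋙ F_f` and the gluing bijections: a point of the chosen copy goes to sheet `0`
  let Gb : ∀ (β : 𝒢.graph.Branch) (u : 𝒢.graph.Vertex) (_ : 𝒢.graph.abuts β = some u),
      𝒢.V u ⥤ FintypeCat.{v₁} := fun β u h => (𝒢.pull β u h).pullback ⋙ FE (𝒢.graph.edgeOf β)
  haveI hGb : ∀ β u h, FiberFunctor (Gb β u h) := fun β u h => fiberFunctor_comp_of_exact _ _
  have hε : ∀ β u h, ∃ (ε : (Gb β u h).obj (S u) ≃ Fin N) (x₀ : (Gb β u h).obj (S u)),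
      x₀ ∈ Set.range ((Gb β u h).map (ιb β u)) ∧ ε x₀ = ⟨0, by omega⟩ := by
    intro β u h
    haveI := hCconn u
    obtain ⟨y⟩ := nonempty_fiber_of_isConnected (Gb β u h) (Cobj u)
    let ε' : (Gb β u h).obj (S u) ≃ Fin N := Finite.equivFinOfCardEq (hcardS u (Gb β u h))
    refine ⟨ε'.trans (Equiv.swap (ε' ((Gb β u h).map (ιb β u) y)) ⟨0, by omega⟩),
      (Gb β u h).map (ιb β u) y, ⟨y, rfl⟩, ?_⟩
    simp
  choose ε x₀ hx₀ hε₀ using hε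
  have hψ : ∀ β u h, ∃ ψ : (𝒢.pull β u h).pullback.obj (S u) ≅ T (𝒢.graph.edgeOf β),
      ∀ x, (FE (𝒢.graph.edgeOf β)).map ψ.hom x = sheet (𝒢.graph.edgeOf β) (ε β u h x) := by
    intro β u h
    haveI : Subsingleton (Aut (FE (𝒢.graph.edgeOf β))) := hE.subsingleton _ _
    exact exists_iso_map_eq_of_subsingleton_aut (FE (𝒢.graph.edgeOf β))
      ((ε β u h).trans (Equiv.ofBijective _ (hsheet (𝒢.graph.edgeOf β))))
  choose ψ hψ using hψ
  let A : 𝒢.BObj := ⟨S, T, ψ⟩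
  -- Step 3: components — the sheet `0` over the edges, the chosen copies over the vertices
  let Q : ∀ f : 𝒢.graph.Edge, π₀Obj (A.T f) := fun f =>
    ⟨Subobject.mk (Sigma.ι (fun _ : Fin N => ⊤_ (𝒢.E f)) ⟨0, by omega⟩),
      isConnected_subobjectMk_sigma_ι _ _⟩
  let Pb : ∀ (β : 𝒢.graph.Branch) (u : 𝒢.graph.Vertex), π₀Obj (A.S u) := fun β u =>
    ⟨Subobject.mk (ιb β u), by
      haveI := hCconn u
      exact isConnected_of_iso (Subobject.underlyingIso (ιb β u)).symm⟩
  have hcomp : ∀ β u h, A.componentOver β u h (Q (𝒢.graph.edgeOf β)) = Pb β u := by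
    intro β u h
    refine componentOver_eq_of_mem A (Gb β u h) β h (FE (𝒢.graph.edgeOf β)) (Iso.refl _)
      (x := x₀ β u h) ?_ ?_
    · change (FE (𝒢.graph.edgeOf β)).map (ψ β u h).hom ((Iso.refl (Gb β u h)).inv.app (S u) (x₀ β u h)) ∈
        Set.range ((FE (𝒢.graph.edgeOf β)).map
          (Subobject.mk (Sigma.ι (fun _ : Fin N => ⊤_ (𝒢.E (𝒢.graph.edgeOf β))) ⟨0, by omega⟩)).arrow)
      rw [range_map_mk_arrow'', Iso.refl_inv, NatTrans.id_app, FintypeCat.id_apply, hψ, hε₀]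
      exact ⟨tE _, rfl⟩
    · change x₀ β u h ∈ Set.range ((Gb β u h).map (Subobject.mk (ιb β u)).arrow)
      rw [range_map_mk_arrow'']
      exact hx₀ β u h
  -- Step 4: the edge `ẽ = (e, 0)` of `𝒢_A` joins `V₁ = (v, [copy 1])` to `V₂ = (w, [copy 2])`
  let fam : ∀ f : 𝒢.graph.Edge, A.fibreData.FE f := fun f => equivShrink _ (Q f)
  let ee : A.fibreData.total.Edge := ⟨e, fam e⟩
  let V₁ : A.fibreData.total.Vertex := ⟨v, equivShrink _ (Pb b₁ v)⟩
  let V₂ : A.fibreData.total.Vertex := ⟨w, equivShrink _ (Pb b₂ w)⟩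
  have habuts : ∀ (β : 𝒢.graph.Branch) (u : 𝒢.graph.Vertex) (h : 𝒢.graph.abuts β = some u),
      A.fibreData.total.abuts ⟨β, fam (𝒢.graph.edgeOf β)⟩ = some ⟨u, equivShrink _ (Pb β u)⟩ := by
    intro β u h
    rw [← hcomp β u h]
    exact coveringGraph_abuts_mk A β h (Q _)
  have hjoins : A.fibreData.total.Joins ee V₁ V₂ := by
    refine ⟨⟨b₁, fam (𝒢.graph.edgeOf b₁)⟩, ⟨b₂, fam (𝒢.graph.edgeOf b₂)⟩,
      fun h => hb12 (congrArg Sigma.fst h), Sigma.ext hb₁ (congr_arg_heq fam hb₁),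
      Sigma.ext hb₂ (congr_arg_heq fam hb₂), habuts b₁ v ha₁, habuts b₂ w ha₂⟩
  -- `V₁ ≠ V₂`: over distinct vertices if `v ≠ w`; at a loop, the two copies are distinct components
  have hV : V₁ ≠ V₂ := by
    intro hVV
    have hvw : v = w := congrArg Sigma.fst hVV
    subst hvw
    have h2 : Pb b₁ v = Pb b₂ v := (equivShrink _).injective (eq_of_heq (Sigma.mk.inj_iff.mp hVV).2)
    have h3 : Subobject.mk (ι₁ v) = Subobject.mk (ι₂ v) := by
      have := congrArg Subtype.val h2
      simp only [Pb, hιb₁, hιb₂] at this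
      exact this
    -- the fibre images of the two copies are disjoint and nonempty
    haveI := hCconn v
    obtain ⟨y⟩ := nonempty_fiber_of_isConnected (FV v) (Cobj v)
    have hr : Set.range ((FV v).map (Subobject.mk (ι₁ v)).arrow) =
        Set.range ((FV v).map (Subobject.mk (ι₂ v)).arrow) := by rw [h3]
    rw [range_map_mk_arrow'', range_map_mk_arrow''] at hr
    have hmem : (FV v).map (ι₁ v) y ∈ Set.range ((FV v).map (ι₂ v)) := hr ▸ ⟨y, rfl⟩
    obtain ⟨z, hz⟩ := hmem
    have hdisj := (fiber_binaryCofan (FV v) (coprod.inl : Cobj v ⟶ S v)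
      (coprod.inr : Cobj v ⨿ (∐ fun _ : Fin (N - 2 * c v) => ⊤_ (𝒢.V v)) ⟶ S v)
      (coprodIsCoprod _ _)).2.2
    have h1 : (FV v).map (ι₁ v) y ∈ Set.range ((FV v).map (coprod.inl : Cobj v ⟶ S v)) := ⟨y, rfl⟩
    have h2' : (FV v).map (ι₁ v) y ∈ Set.range ((FV v).map
        (coprod.inr : Cobj v ⨿ (∐ fun _ : Fin (N - 2 * c v) => ⊤_ (𝒢.V v)) ⟶ S v)) := by
      refine ⟨(FV v).map coprod.inl z, ?_⟩
      rw [← hz]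
      change _ = (FV v).map (coprod.inl ≫ coprod.inr) z
      rw [(FV v).map_comp, FintypeCat.comp_apply]
    exact Set.disjoint_iff.mp hdisj.disjoint ⟨h1, h2'⟩
  -- Step 5: `𝒢_A` has trivial edge anabelioids, and `ẽ` is sub-coverticial by universality
  obtain ⟨A', hloc, -, -, -⟩ := A.coveringHom_isFiniteEtaleCoveringGlobal
  have hsub : A.coveringGraph.IsSubCoverticial ee :=
    hU.2 A.coveringGraph A.coveringHom A.coveringHom_isFiniteEtaleCoveringGlobal ee rfl
  -- hence `Π_{V₁}` is nontrivial …
  let F₁ : A.coveringGraph.V V₁ ⥤ FintypeCat.{v₁} := GaloisCategory.getFiberFunctor _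
  have hnt : Nontrivial (Aut F₁) := nontrivial_of_isSubCoverticial_of_ne hjoins hV hsub F₁
  -- … but `Π_{V₁}` is the stabiliser of a point of the fibre of the free `X`, i.e. trivial
  let S₀ : 𝒢.V (A.fibreData.proj.vertexMap V₁) :=
    ((A.vComp V₁).1 : 𝒢.V (A.fibreData.proj.vertexMap V₁))
  haveI : PreGaloisCategory.IsConnected S₀ := (A.vComp V₁).2
  let α : Over S₀ ⥤ A.coveringGraph.V V₁ := (Shrink.equivalence (Over S₀)).functor
  let Qf : 𝒢.V (A.fibreData.proj.vertexMap V₁) ⥤ A.coveringGraph.V V₁ :=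
    (A.coveringHom.φV V₁).pullback
  have eQ : Qf ≅ Over.star S₀ ⋙ α := Iso.refl _
  let G₁ : 𝒢.V (A.fibreData.proj.vertexMap V₁) ⥤ FintypeCat.{v₁} := Qf ⋙ F₁
  haveI : FiberFunctor G₁ := fiberFunctor_comp_of_exact _ _
  -- `S₀` is (isomorphic to) the first copy of `X`, on whose fibre `Aut G₁` acts freely
  have hvc : A.vComp V₁ = Pb b₁ v := Equiv.symm_apply_apply _ _
  have hS₀free : ∀ (σ : Aut G₁) (x : G₁.obj S₀), σ • x = x → σ = 1 := by
    have i : S₀ ≅ Cobj v := by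
      change ((A.vComp V₁).1 : 𝒢.V (A.fibreData.proj.vertexMap V₁)) ≅ Cobj v
      rw [hvc]
      exact Subobject.underlyingIso (ιb b₁ v)
    exact free_of_iso G₁ i (@hCfree v rfl G₁ ‹FiberFunctor G₁›)
  have hT : IsTerminal (α.obj (Over.mk (𝟙 S₀))) := Over.mkIdTerminal.isTerminalObj α _
  obtain ⟨t₀⟩ := (nonempty_equiv_fiber_terminal_punit F₁).map fun eq => eq.symm PUnit.unit
  let t : F₁.obj (α.obj (Over.mk (𝟙 S₀))) := F₁.map (hT.uniqueUpToIso terminalIsTerminal).inv t₀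
  have hinj : Function.Injective (pi1Map Qf F₁) := pi1Map_injective_of_star_comp α eQ F₁
  have hle := range_pi1Map_le_stabilizer α eQ F₁ (Iso.refl G₁) t
  haveI : Subsingleton (Aut F₁) := by
    refine ⟨fun σ τ => hinj ?_⟩
    have hσ : (Aut.autMulEquivOfIso (Iso.refl G₁)) (pi1Map Qf F₁ σ) = 1 :=
      hS₀free _ _ (MulAction.mem_stabilizer_iff.mp (hle ⟨σ, rfl⟩))
    have hτ : (Aut.autMulEquivOfIso (Iso.refl G₁)) (pi1Map Qf F₁ τ) = 1 :=
      hS₀free _ _ (MulAction.mem_stabilizer_iff.mp (hle ⟨τ, rfl⟩))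
    exact (Aut.autMulEquivOfIso (Iso.refl G₁)).injective (hσ.trans hτ.symm)
  exact not_nontrivial (Aut F₁) hnt

/-- **Necessity at both ends**: trivial edge anabelioids, `e` joins `v`, `w`, `e` universally
sub-coverticial ⇒ `Π_v` and `Π_w` infinite. [cite: MochizukiSemiAnbd2006, Ex. 2.8 p.31] -/
theorem infinite_and_infinite_of_isUniversallySubCoverticial (hE : 𝒢.HasTrivialEdgeAnabelioids)
    {e : 𝒢.graph.Edge} {v w : 𝒢.graph.Vertex} (hj : 𝒢.graph.Joins e v w)
    (hU : 𝒢.IsUniversallySubCoverticial e) :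
    (∀ (F : 𝒢.V v ⥤ FintypeCat.{v₁}) [FiberFunctor F], Infinite (Aut F)) ∧
      ∀ (F : 𝒢.V w ⥤ FintypeCat.{v₁}) [FiberFunctor F], Infinite (Aut F) := by
  obtain ⟨b₁, b₂, hb12, hb₁, hb₂, ha₁, ha₂⟩ := hj
  exact ⟨fun F _ => infinite_of_isUniversallySubCoverticial hE ⟨b₁, b₂, hb12, hb₁, hb₂, ha₁, ha₂⟩ hU F,
    fun F _ => infinite_of_isUniversallySubCoverticial hE ⟨b₂, b₁, hb12.symm, hb₂, hb₁, ha₂, ha₁⟩ hU F⟩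

end SemiGraphOfAnabelioids

end Literature.AnabelianGeometry.SemiGraphs
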